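import Mathlib
import HarnessLib
import Summits.NavierStokesRegularity.NavierStokesRegularity.Theses.ExtremalTypeIConstant
import Summits.NavierStokesRegularity.NavierStokesRegularity.Theses.DulacContraction
import Summits.NavierStokesRegularity.NavierStokesRegularity.Theorems.ExtremalTypeIConstantMinimiserExists
import Summits.NavierStokesRegularity.NavierStokesRegularity.Theorems.ExtremalTypeIConstantExtremalSpiralSymmetryTargetOfRecurrence
import Summits.NavierStokesRegularity.NavierStokesRegularity.Theorems.ExtremalTypeIConstantExtremalSpiralSymmetrySelfRecurrentExtremal

/-!
# Crux `ExtremalSpiralSymmetry` (stmt-NavierStokesRegularity-8215), line `registered` — structural consequence: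
# the route target from the RDSS wall and an exact period for RECURRENT extremals only

Support file (theorems only, `--supports stmt-NavierStokesRegularity-8215`; no definitions, no named facts). Lead c2.

`…TargetOfRecurrence.lean` derived the route target from stmt-8561 and the recurrence stub for EVERY extremal pair.
Since SOME extremal pair is a blow-down of itself whenever one exists (`exists_selfRecurrent_extremal`, unconditional),
the recurrence hypothesis may be restricted to such RECURRENT extremals:

* `typeIAncientLiouville_of_periodOfRecurrent_of_rdssLiouvilleInClass` —
  `RDSSLiouvilleInClass → (every extremal pair which is a blow-down of itself has an exact scaling period modulo a rigid
  motion and a forward time shift) → TypeIAncientLiouville`.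
  Proof: a nontrivial element gives an extremal pair (`MinimiserExists`, proved), hence a recurrent one
  (`exists_selfRecurrent_extremal`); the hypothesis gives it a period, pinned to `δ = 0` (`timeShift_pinned`), centred
  to an RDSS identity with factor `> 1` (`stub_periodToRDSS`), killed by the wall
  (`stub_rdssLiouville_of_rdssLiouvilleInClass`) — contradicting `‖W(−1,0)‖ = C > 0`.

So on the recurrence route the route's whole new content is: "approximate scaling periods `λ_j → ∞` (modulo translations)
of an extremal pair force an exact one". CONDITIONAL on stmt-8561 and on that hypothesis (explicit, never asserted).
-/

noncomputable section

-- the summit and its single sub-problem share the name (CONVENTIONS §1), as in every Theorems file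
set_option linter.dupNamespace false

open Set MeasureTheory Filter Topology
open Literature.Analysis.FluidPDE

namespace Summit.NavierStokesRegularity.NavierStokesRegularity.Theorems.ExtremalSpiralSymmetry.Registered

/-- **The route target from the RDSS wall and periods of recurrent extremals.** Assume crux stmt-8561
(`DulacContraction.RDSSLiouvilleInClass`) and: every extremal pair `(C, W)` which is a blow-down of itself
(`λ_j W(λ_j²t, x_j + λ_j x) → W(t,x)` on the slab, `λ_j → ∞`) has an exact scaling period modulo a rigid motion and a
forward time shift. Then `TypeIAncientLiouville` (stmt-4050). CONDITIONAL on both hypotheses. [folklore] -/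
theorem typeIAncientLiouville_of_periodOfRecurrent_of_rdssLiouvilleInClass :
    _root_.Summit.NavierStokesRegularity.NavierStokesRegularity.Theses.DulacContraction.RDSSLiouvilleInClass →
    (∀ (C : ℝ) (W : ℝ → EuclideanSpace ℝ (Fin 3) → EuclideanSpace ℝ (Fin 3)), 0 < C →
      (ContDiffOn ℝ (⊤ : ℕ∞) (Function.uncurry W) (Set.Iio 0 ×ˢ Set.univ) ∧
          (∀ t < 0, Literature.Analysis.FluidPDE.VectorCalculus.IsDivFree (W t)) ∧
          (∀ s t : ℝ, s < t → t < 0 → ∀ x, W t x =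
            Literature.Analysis.FluidPDE.heatFlow (W s) (t - s) x -
              ∫ τ in Set.Ioo s t, ∫ y,
                Literature.Analysis.FluidPDE.oseenKernel (t - τ) (x - y) (W τ y) (W τ y)) ∧
          Literature.Analysis.FluidPDE.HasTypeITimeDecay C W) ∧
        ‖W (-1) 0‖ = C ∧
        (∀ (C' : ℝ) (u' : ℝ → EuclideanSpace ℝ (Fin 3) → EuclideanSpace ℝ (Fin 3)),
          (ContDiffOn ℝ (⊤ : ℕ∞) (Function.uncurry u') (Set.Iio 0 ×ˢ Set.univ) ∧
            (∀ t < 0, Literature.Analysis.FluidPDE.VectorCalculus.IsDivFree (u' t)) ∧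
            (∀ s t : ℝ, s < t → t < 0 → ∀ x, u' t x =
              Literature.Analysis.FluidPDE.heatFlow (u' s) (t - s) x -
                ∫ τ in Set.Ioo s t, ∫ y,
                  Literature.Analysis.FluidPDE.oseenKernel (t - τ) (x - y) (u' τ y) (u' τ y)) ∧
            Literature.Analysis.FluidPDE.HasTypeITimeDecay C' u') →
          (∃ t < 0, ∃ x, u' t x ≠ 0) → C ≤ C') →
      (∃ (lam : ℕ → ℝ) (xs : ℕ → EuclideanSpace ℝ (Fin 3)), (∀ j, 0 < lam j) ∧ Tendsto lam atTop atTop ∧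
        ∀ t < (0 : ℝ), ∀ x, Tendsto (fun j => lam j • W (lam j ^ 2 * t) (xs j + lam j • x)) atTop
          (𝓝 (W t x))) →
      ∃ c : ℝ, 0 < c ∧ c ≠ 1 ∧ ∃ (δ : ℝ) (b : EuclideanSpace ℝ (Fin 3))
        (R : EuclideanSpace ℝ (Fin 3) ≃ₗᵢ[ℝ] EuclideanSpace ℝ (Fin 3)), 0 ≤ δ ∧
        ∀ t < 0, ∀ x, c • W (c ^ 2 * t) (c • x) = R (W (t - δ) (R.symm (x - b)))) →
    _root_.Summit.NavierStokesRegularity.NavierStokesRegularity.Theses.ExtremalTypeIConstant.TypeIAncientLiouville := by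
  intro h8561 hper C u hcls t ht x
  by_contra hne
  -- a nontrivial element gives an extremal pair, hence a RECURRENT extremal pair
  obtain ⟨C₁, w, hC₁, hclsw, hnormw, hminw⟩ :=
    _root_.Summit.NavierStokesRegularity.NavierStokesRegularity.Theorems.extremalTypeIConstant_minimiserExists_proof
      ⟨C, u, hcls, t, ht, x, hne⟩
  obtain ⟨C', W, hC', ⟨hclsW, hnorm, hmin⟩, hrec⟩ :=
    exists_selfRecurrent_extremal ⟨C₁, w, hC₁, hclsw, hnormw, hminw⟩
  -- its period, pinned and centred, is killed by the wall
  obtain ⟨c, hc, hc1, δ, b, R, hδ, heq⟩ := hper C' W hC' ⟨hclsW, hnorm, hmin⟩ hrec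
  have hδ0 : δ = 0 := timeShift_pinned hC' hclsW.2.2.2 hnorm hc hδ heq
  subst hδ0
  have heq' : ∀ s < (0 : ℝ), ∀ y, c • W (c ^ 2 * s) (c • y) = R (W s (R.symm (y - b))) := fun s hs y => by
    simpa only [sub_zero] using heq s hs y
  obtain ⟨c', R', x₀, hc'1, hrdss⟩ := stub_periodToRDSS W c b R hc hc1 heq'
  have h0 := stub_rdssLiouville_of_rdssLiouvilleInClass h8561 C' W c' R' x₀ hclsW hc'1 hrdss (-1)
    (by norm_num) 0
  rw [h0, norm_zero] at hnorm
  exact absurd hnorm hC'.ne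

end Summit.NavierStokesRegularity.NavierStokesRegularity.Theorems.ExtremalSpiralSymmetry.Registered

end
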